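import Literature.Barriers.CriticalPhenomena.KozmaNachmiasAdmissible
import HarnessLib

/-!
# Kozma–Nachmias 2011, Chapter 5: the event `E₁(x, M, K)`, events saturated for the
# conditioning on `C(x; Q_j)`, and the regularity estimate behind (5.7), (5.11)–(5.12)

Barrier catalogue `Literature/Barriers/CriticalPhenomena/` (D-0021), programme for the named fact
`KozmaNachmias2011_thm2` (Theorem 2 of Kozma–Nachmias 2011, the residual input of the one-arm
upper bound `KozmaNachmias2011_oneArmUpper`, see `KozmaNachmiasLemma23OfThm2.lean`). Chapter 5 of
the source (pp. 398–406) works throughout with the event (p. 399)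

`E₁(x, M, K) = {0 ↔ x in Q_j, x is K-regular and X_j^{K-reg} = M}`

and repeatedly "conditions on `C(x; Q_j) = A`" (Lemma 5.3, (5.3); Lemma 5.5, (5.10)–(5.12)),
using that "`E₁` can be determined by observing only the edges of `C(x; Q_j)`" (p. 400) and that,
for `x` `K`-regular, the conditional probability of a non-typical cluster is small:
"`P(¬T_{2^{t+1}}(x) | C(x; Q_j) = A) ≤ e^{-t²}`" (p. 403, the use of Definition 4.1), as well as
the "simple bad configuration" remark (5.7): an admissible `A` cannot contain `s⁴ log⁷ s` vertices
of `x + Q_s` for `s ≥ K`. This file vendors `E₁` with a real body (`eventE1`) and PROVES these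
three mechanisms once and for all, for events **saturated** for the atoms of the conditioning
(`∀ ω ∈ E, clusterAtom S x ω ⊆ E`, the Lean form of "determined by the edges of `C(x; S)`"):

* `clusterInIs S x C = {C(x; S) = C}`; it and `E ∩ {C(x; S) = C}` (for saturated `E`) are
  determined by the conditioned pairs `clusterPairs S C`; the decomposition
  `P(E) = Σ_C P(E ∩ {C(x;S) = C})` (`measureReal_eq_sum_inter_clusterInIs`) and the independence
  `P(E ∩ {C(x;S) = C} ∩ G) = P(E ∩ {C(x;S) = C}) P(G)` for `G` determined by pairs disjoint from
  `clusterPairs S C` (`real_inter_clusterInIs_inter_eq`, the step "(5.3)–(5.4)" of Lemma 5.3);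
* **the regularity estimate** `real_inter_compl_le_of_saturated`: if `E` is saturated and
  `P(T | C(x;S))(ω) ≥ 1 - δ` for all `ω ∈ E`, then `P(E ∩ Tᶜ) ≤ δ P(E)` — with `T = T_s(x)`,
  `δ = e^{-log² s}`, this is how `K`-regularity is used in (5.11)–(5.12);
* **(5.7)**, pointwise: if `x` is not `s`-bad at `ω`, then
  `|{z ∈ Q_s : x + z ∈ C(x; Q_j)(ω)}| < s⁴ log⁷ s` (`card_filter_add_mem_clusterIn_lt`), and the atom
  of `ω` has positive probability (`measureReal_clusterAtom_pos_of_not_isSBad`);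
* `eventE1 p j K M x = E₁(x, M, K)`; it is saturated (`clusterAtom_subset_eventE1`), local
  (`determinedBy_eventE1`), `x` is not `s`-bad on it for `s ≥ K`, and the counting identities
  `Σ_{x ∈ ∂Q_j} P(E₁(x) ∩ H) = M · P({X^{K-reg} = M} ∩ H)` (`sum_real_eventE1_inter`; p. 405: "the
  last equality follows by definition of `E₁`") and
  `Σ_{x₁,x₂} P(E₁(x₁) ∩ E₁(x₂)) = M² P(X^{K-reg} = M)` (`sum_sum_real_eventE1_inter_eventE1`, used for
  the term `S₃` of Lemma 5.2).

All objects are those of `KozmaNachmiasRegularity.lean` (`clusterIn`, `clusterAtom`,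
`condProbCluster`, `IsSBad`, `IsKIrregular`, `regBoundaryConnCount`, `typicalEvent`).

## References

* G. Kozma, A. Nachmias, *Arm exponents in high dimensional percolation*, J. Amer. Math. Soc. 24
  (2011) 375–409: Definition 4.1 (p. 389); Chapter 5: `E₁, E₂, E₃` (p. 399), proof of Lemma 5.3
  ((5.3)–(5.7), pp. 400–401), proof of Lemma 5.5 ((5.10)–(5.12), pp. 402–403), proof of
  Lemma 5.2 (`S₁`, `S₃`, p. 405).
-/

noncomputable section

namespace Literature.Barriers.CriticalPhenomena

open _root_.MeasureTheory Finset Literature.Probability.LatticeModels Literature.Probability.Percolation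
  Literature.Probability.Percolation.DCT16
open scoped Literature.Probability.LatticeModels Literature.Probability.Percolation

variable {d : ℕ}

/-! ### Clusters inside `S`: symmetry and change of base point -/

section ClusterIn

/-- `openConnIn` is symmetric. [folklore] -/
private theorem openConnIn_mem_comm {V : Type*} {S : Set V} {x y : V} {ω : BondConfig V} :
    ω ∈ openConnIn S x y ↔ ω ∈ openConnIn S y x :=
  ⟨fun ⟨hx, hy, h⟩ => ⟨hy, hx, h.symm⟩, fun ⟨hy, hx, h⟩ => ⟨hx, hy, h.symm⟩⟩

/-- `openConnIn` is transitive. [folklore] -/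
private theorem mem_openConnIn_trans {V : Type*} {S : Set V} {x y z : V} {ω : BondConfig V}
    (h₁ : ω ∈ openConnIn S x y) (h₂ : ω ∈ openConnIn S y z) : ω ∈ openConnIn S x z := by
  obtain ⟨hx, _, h⟩ := h₁
  obtain ⟨_, hz, h'⟩ := h₂
  exact ⟨hx, hz, h.trans h'⟩

/-- **Change of base point**: `C(y; S) = C(x; S)` for `y ∈ C(x; S)`. [folklore] -/
theorem clusterIn_eq_of_mem_clusterIn {S : Finset (Site d)} {x y : Site d} {ω : BondConfig (Site d)}
    (hy : y ∈ clusterIn S x ω) : clusterIn S y ω = clusterIn S x ω := by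
  rw [mem_clusterIn] at hy
  ext z
  rw [mem_clusterIn, mem_clusterIn]
  exact ⟨fun h => mem_openConnIn_trans hy h, fun h => mem_openConnIn_trans (openConnIn_mem_comm.1 hy) h⟩

/-- The atoms of the conditionings on `C(y; S)` and on `C(x; S)` coincide at `ω` when
`y ∈ C(x; S)(ω)`. [folklore] -/
theorem clusterAtom_eq_of_mem_clusterIn {S : Finset (Site d)} {x y : Site d} {ω : BondConfig (Site d)}
    (hy : y ∈ clusterIn S x ω) : clusterAtom S y ω = clusterAtom S x ω := by
  rw [clusterAtom, clusterAtom, clusterIn_eq_of_mem_clusterIn hy]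

end ClusterIn

/-! ### The events `{C(x; S) = C}` and saturated events -/

section Saturated

variable (S : Finset (Site d)) (x : Site d)

/-- **`{C(x; S) = C}`**: the cluster of `x` inside `S` is exactly `C` (Kozma–Nachmias 2011, (5.3):
"we condition on `C(x; Q_j) = A`"). [cite: KozmaNachmias2011, proof of Lemma 5.3 ((5.3), p. 400)] -/
def clusterInIs (C : Finset (Site d)) : Set (BondConfig (Site d)) := {ω | clusterIn S x ω = C}

variable {S x}

/-- Unfolding lemma. [folklore] -/
theorem mem_clusterInIs {C : Finset (Site d)} {ω : BondConfig (Site d)} :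
    ω ∈ clusterInIs S x C ↔ clusterIn S x ω = C := Iff.rfl

/-- Agreement on `clusterPairs S (C(x;S)(ω))` is membership in the atom. [folklore] -/
theorem mem_clusterAtom_of_inter_eq {C : Finset (Site d)} {ω ω' : BondConfig (Site d)}
    (hC : clusterIn S x ω = C)
    (h : ω ∩ (↑(clusterPairs S C) : Set (Sym2 (Site d))) = ω' ∩ ↑(clusterPairs S C)) :
    ω' ∈ clusterAtom S x ω := by
  rw [mem_clusterAtom_iff, hC]
  intro e he
  have he' : e ∈ (↑(clusterPairs S C) : Set (Sym2 (Site d))) := Finset.mem_coe.2 he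
  exact ⟨fun h1 => (((Set.ext_iff.1 h) e).2 ⟨h1, he'⟩).1, fun h1 => (((Set.ext_iff.1 h) e).1 ⟨h1, he'⟩).1⟩

/-- **`{C(x; S) = C}` is determined by the conditioned pairs `clusterPairs S C`** (the exploration
property `clusterIn_eq_of_mem_clusterAtom`). [cite: KozmaNachmias2011, Definition 4.1 (p. 389)] -/
theorem determinedBy_clusterInIs (S : Finset (Site d)) (x : Site d) (C : Finset (Site d)) :
    DeterminedBy (clusterInIs S x C) ↑(clusterPairs S C) := by
  rw [determinedBy_iff]
  suffices key : ∀ ω ω' : BondConfig (Site d),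
      ω ∩ ↑(clusterPairs S C) = ω' ∩ ↑(clusterPairs S C) → ω ∈ clusterInIs S x C → ω' ∈ clusterInIs S x C from
    fun ω ω' h => ⟨key ω ω' h, key ω' ω h.symm⟩
  intro ω ω' h hω
  rw [mem_clusterInIs] at hω ⊢
  rw [clusterIn_eq_of_mem_clusterAtom (mem_clusterAtom_of_inter_eq hω h), hω]

/-- **A saturated event, cut by `{C(x; S) = C}`, is determined by `clusterPairs S C`** ("`E₁` can be
determined by observing only the edges of `C(x; Q_j)`", Kozma–Nachmias 2011, p. 400).
[cite: KozmaNachmias2011, proof of Lemma 5.3 (p. 400)] -/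
theorem determinedBy_inter_clusterInIs {E : Set (BondConfig (Site d))}
    (hE : ∀ ω ∈ E, clusterAtom S x ω ⊆ E) (C : Finset (Site d)) :
    DeterminedBy (E ∩ clusterInIs S x C) ↑(clusterPairs S C) := by
  rw [determinedBy_iff]
  suffices key : ∀ ω ω' : BondConfig (Site d),
      ω ∩ ↑(clusterPairs S C) = ω' ∩ ↑(clusterPairs S C) →
        ω ∈ E ∩ clusterInIs S x C → ω' ∈ E ∩ clusterInIs S x C from
    fun ω ω' h => ⟨key ω ω' h, key ω' ω h.symm⟩
  rintro ω ω' h ⟨hωE, hωC⟩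
  have hat : ω' ∈ clusterAtom S x ω := mem_clusterAtom_of_inter_eq hωC h
  exact ⟨hE ω hωE hat, by rw [mem_clusterInIs, clusterIn_eq_of_mem_clusterAtom hat, hωC]⟩

/-- **A saturated event is determined by the pairs of `S`** (in particular it is local and
measurable). [folklore] -/
theorem determinedBy_of_saturated {E : Set (BondConfig (Site d))}
    (hE : ∀ ω ∈ E, clusterAtom S x ω ⊆ E) : DeterminedBy E ↑S.sym2 := by
  rw [determinedBy_iff]
  suffices key : ∀ ω ω' : BondConfig (Site d), ω ∩ ↑S.sym2 = ω' ∩ ↑S.sym2 → ω ∈ E → ω' ∈ E from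
    fun ω ω' h => ⟨key ω ω' h, key ω' ω h.symm⟩
  intro ω ω' h hω
  refine hE ω hω (mem_clusterAtom_iff.2 fun e he => ?_)
  have he' : e ∈ (↑S.sym2 : Set (Sym2 (Site d))) := Finset.mem_coe.2 (Finset.sdiff_subset he)
  exact ⟨fun h1 => (((Set.ext_iff.1 h) e).2 ⟨h1, he'⟩).1, fun h1 => (((Set.ext_iff.1 h) e).1 ⟨h1, he'⟩).1⟩

/-- A saturated event is measurable. [folklore] -/
theorem measurableSet_of_saturated {E : Set (BondConfig (Site d))}
    (hE : ∀ ω ∈ E, clusterAtom S x ω ⊆ E) : MeasurableSet E :=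
  (determinedBy_of_saturated hE).measurableSet_of_finset

/-- `{C(x;S) = C}` is measurable. [folklore] -/
theorem measurableSet_clusterInIs (S : Finset (Site d)) (x : Site d) (C : Finset (Site d)) :
    MeasurableSet (clusterInIs S x C) :=
  (determinedBy_clusterInIs S x C).measurableSet_of_finset

/-- **Decomposition according to the value of `C(x; S)`** (Kozma–Nachmias 2011, (5.3)): for a
measurable `E`, `P(E) = Σ_{C ⊆ S} P(E ∩ {C(x;S) = C})`. [cite: KozmaNachmias2011, proof of Lemma 5.3 ((5.3), p. 400)] -/
theorem measureReal_eq_sum_inter_clusterInIs (p : unitInterval) (S : Finset (Site d)) (x : Site d)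
    {E : Set (BondConfig (Site d))} (hEm : MeasurableSet E) :
    (bondPercolation (zdGraph d) p).real E =
      ∑ C ∈ S.powerset, (bondPercolation (zdGraph d) p).real (E ∩ clusterInIs S x C) := by
  classical
  have hU : E = ⋃ C ∈ S.powerset, (E ∩ clusterInIs S x C) := by
    ext ω
    simp only [Set.mem_iUnion, Set.mem_inter_iff, exists_and_left, exists_prop]
    exact ⟨fun h => ⟨h, clusterIn S x ω, Finset.mem_powerset.2 (clusterIn_subset S x ω), rfl⟩,
      fun h => h.1⟩
  have hdisj : (↑S.powerset : Set (Finset (Site d))).PairwiseDisjoint fun C => E ∩ clusterInIs S x C := by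
    intro C₁ _ C₂ _ hne
    rw [Function.onFun, Set.disjoint_left]
    rintro ω ⟨-, h₁⟩ ⟨-, h₂⟩
    exact hne (h₁.symm.trans h₂)
  conv_lhs => rw [hU]
  exact measureReal_biUnion_finset hdisj fun C _ => hEm.inter (measurableSet_clusterInIs S x C)

/-- **Independence given the cluster** (Kozma–Nachmias 2011, (5.3)–(5.4): "Since the event
`{x' ↔ y off A}` depends only on the status of edges not touching `A` we have
`P(x' ↔ y off A | C(x; Q_j) = A) = P(x' ↔ y off A)`"): for a saturated `E` and an event `G`
determined by a set of pairs disjoint from `clusterPairs S C`,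
`P(E ∩ {C(x;S) = C} ∩ G) = P(E ∩ {C(x;S) = C}) · P(G)`.
[cite: KozmaNachmias2011, proof of Lemma 5.3 ((5.3)–(5.4), p. 400)] -/
theorem real_inter_clusterInIs_inter_eq (p : unitInterval) {E : Set (BondConfig (Site d))}
    (hE : ∀ ω ∈ E, clusterAtom S x ω ⊆ E) (C : Finset (Site d)) {G : Set (BondConfig (Site d))}
    {K : Set (Sym2 (Site d))} (hG : DeterminedBy G K) (hGm : MeasurableSet G)
    (hK : Disjoint (↑(clusterPairs S C) : Set (Sym2 (Site d))) K) :
    (bondPercolation (zdGraph d) p).real (E ∩ clusterInIs S x C ∩ G) =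
      (bondPercolation (zdGraph d) p).real (E ∩ clusterInIs S x C) *
        (bondPercolation (zdGraph d) p).real G :=
  bondPercolation_real_inter_of_disjoint (zdGraph d) p hK (determinedBy_inter_clusterInIs hE C) hG
    (determinedBy_inter_clusterInIs hE C).measurableSet_of_finset hGm

/-- **The regularity estimate** (Kozma–Nachmias 2011, pp. 402–403, the use of Definition 4.1 in
(5.11)–(5.12): "since `x` is `K`-regular it is not `2^{t+1}`-bad for `t > t₀`, so …
`P(¬T_{2^{t+1}}(x) | C(x; Q_j) = A) ≤ e^{-t²}`", summed over the admissible `A`): if `E` is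
saturated for the conditioning on `C(x; S)` and `P(T | C(x;S))(ω) ≥ 1 - δ` for every `ω ∈ E`,
then `P(E ∩ Tᶜ) ≤ δ · P(E)`. Proof: `E ∩ {C(x;S) = C}` is a disjoint union of cylinders over
`clusterPairs S C`, each of which is the atom of one of its members.
[cite: KozmaNachmias2011, proof of Lemma 5.5 ((5.11)–(5.12), pp. 402–403)] -/
theorem real_inter_compl_le_of_saturated (p : unitInterval) {E T : Set (BondConfig (Site d))}
    (hE : ∀ ω ∈ E, clusterAtom S x ω ⊆ E) (hTm : MeasurableSet T) {δ : ℝ}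
    (hcond : ∀ ω ∈ E, 1 - δ ≤ condProbCluster p S x T ω) :
    (bondPercolation (zdGraph d) p).real (E ∩ Tᶜ) ≤ δ * (bondPercolation (zdGraph d) p).real E := by
  classical
  set μ := bondPercolation (zdGraph d) p with hμ
  -- reduce to one value `C` of the cluster
  suffices key : ∀ C : Finset (Site d),
      μ.real (E ∩ Tᶜ ∩ clusterInIs S x C) ≤ δ * μ.real (E ∩ clusterInIs S x C) by
    have hEm : MeasurableSet E := measurableSet_of_saturated hE
    rw [measureReal_eq_sum_inter_clusterInIs p S x (hEm.inter hTm.compl),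
      measureReal_eq_sum_inter_clusterInIs p S x hEm, Finset.mul_sum]
    exact Finset.sum_le_sum fun C _ => key C
  intro C
  set D : Finset (Sym2 (Site d)) := clusterPairs S C with hD
  set A : Set (BondConfig (Site d)) := E ∩ clusterInIs S x C with hA
  have hAD : DeterminedBy A ↑D := determinedBy_inter_clusterInIs hE C
  set cyl : Finset (Sym2 (Site d)) → Set (BondConfig (Site d)) := fun π =>
    localCylinder (↑D : Set (Sym2 (Site d))) (↑π : Set (Sym2 (Site d))) with hcyl
  set Ps : Finset (Finset (Sym2 (Site d))) :=
    D.powerset.filter fun π => (↑π : Set (Sym2 (Site d))) ∈ A with hPs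
  have hAeq : A = ⋃ π ∈ Ps, cyl π := by
    simp only [hPs, hcyl]
    convert hAD.eq_biUnion_localCylinder
  have hPs_sub : ∀ π ∈ Ps, π ⊆ D ∧ (↑π : Set (Sym2 (Site d))) ∈ A := fun π hπ => by
    have h := Finset.mem_filter.1 hπ
    exact ⟨Finset.mem_powerset.1 h.1, h.2⟩
  have hdisj : (↑Ps : Set (Finset (Sym2 (Site d)))).PairwiseDisjoint cyl := by
    intro π₁ h₁ π₂ h₂ hne
    exact Russo.disjoint_localCylinder (hPs_sub π₁ (Finset.mem_coe.1 h₁)).1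
      (hPs_sub π₂ (Finset.mem_coe.1 h₂)).1 hne
  have hdisj' : (↑Ps : Set (Finset (Sym2 (Site d)))).PairwiseDisjoint fun π => Tᶜ ∩ cyl π :=
    fun π₁ h₁ π₂ h₂ hne => (hdisj h₁ h₂ hne).mono Set.inter_subset_right Set.inter_subset_right
  have hcylm : ∀ π, MeasurableSet (cyl π) := fun π =>
    measurableSet_localCylinder (Finset.countable_toSet _) _
  have h1 : μ.real A = ∑ π ∈ Ps, μ.real (cyl π) := by
    rw [hAeq]; exact measureReal_biUnion_finset hdisj fun π _ => hcylm π
  have h2 : μ.real (E ∩ Tᶜ ∩ clusterInIs S x C) = ∑ π ∈ Ps, μ.real (Tᶜ ∩ cyl π) := by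
    have : E ∩ Tᶜ ∩ clusterInIs S x C = ⋃ π ∈ Ps, (Tᶜ ∩ cyl π) := by
      rw [← Set.inter_iUnion₂, ← hAeq, hA]
      ext ω; simp only [Set.mem_inter_iff, Set.mem_compl_iff]; tauto
    rw [this]; exact measureReal_biUnion_finset hdisj' fun π _ => hTm.compl.inter (hcylm π)
  -- each cylinder is the atom of the configuration `π`, on which `P(T | atom) ≥ 1 - δ`
  have hterm : ∀ π ∈ Ps, μ.real (Tᶜ ∩ cyl π) ≤ δ * μ.real (cyl π) := by
    intro π hπ
    have hπA : (↑π : Set (Sym2 (Site d))) ∈ A := (hPs_sub π hπ).2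
    have hatom : clusterAtom S x (↑π : Set (Sym2 (Site d))) = cyl π := by
      rw [clusterAtom, mem_clusterInIs.1 hπA.2]
    have hc := hcond _ hπA.1
    rw [condProbCluster, hatom] at hc
    have hsplit : μ.real (cyl π ∩ T) + μ.real (cyl π \ T) = μ.real (cyl π) :=
      measureReal_inter_add_sdiff hTm
    have hdiff : cyl π \ T = Tᶜ ∩ cyl π := by
      ext ω; simp only [Set.mem_sdiff, Set.mem_inter_iff, Set.mem_compl_iff]; tauto
    rw [hdiff, Set.inter_comm] at hsplit
    rcases (measureReal_nonneg (μ := μ) (s := cyl π)).eq_or_lt with h0 | hpos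
    · have : μ.real (Tᶜ ∩ cyl π) = 0 :=
        le_antisymm (h0 ▸ measureReal_mono Set.inter_subset_right) measureReal_nonneg
      rw [this, ← h0, mul_zero]
    · rw [le_div_iff₀ hpos] at hc
      linarith
  calc μ.real (E ∩ Tᶜ ∩ clusterInIs S x C) = ∑ π ∈ Ps, μ.real (Tᶜ ∩ cyl π) := h2
    _ ≤ ∑ π ∈ Ps, δ * μ.real (cyl π) := Finset.sum_le_sum hterm
    _ = δ * μ.real A := by rw [h1, Finset.mul_sum]

end Saturated

/-! ### Definition 4.1 at a configuration that is not `s`-bad: positivity and (5.7) -/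

section NotBad

/-- If `x` is not `s`-bad at `ω`, the atom of `ω` has positive probability (a null atom has
conditional probability `0` by convention, hence is `s`-bad). [folklore] -/
theorem measureReal_clusterAtom_pos_of_not_isSBad {p : unitInterval} {j s : ℕ} {x : Site d}
    {ω : BondConfig (Site d)} (h : ¬IsSBad p j s x ω) :
    0 < (bondPercolation (zdGraph d) p).real (clusterAtom (box d j) x ω) := by
  by_contra h0
  have h0' : (bondPercolation (zdGraph d) p).real (clusterAtom (box d j) x ω) = 0 :=
    le_antisymm (not_lt.1 h0) measureReal_nonneg
  apply h
  rw [IsSBad, condProbCluster, h0', div_zero, sub_nonneg]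
  exact Real.exp_le_one_iff.2 (neg_nonpos.2 (sq_nonneg _))

/-- A vertex of `C(x; S)(ω')` is joined to `x` in `ω'`. [folklore] -/
theorem mem_openConn_of_mem_clusterIn {S : Finset (Site d)} {x y : Site d} {ω : BondConfig (Site d)}
    (hy : y ∈ clusterIn S x ω) : ω ∈ openConn x y :=
  reachable_of_pathIn (mem_clusterIn_iff_pathIn.1 hy)

/-- **(5.7), pointwise** (Kozma–Nachmias 2011, p. 401: "if `|A_t| ≥ 2^{4(t+1)} (t+1)⁷`, then
directly from the definition of `T` we have that `P(T_{2^{t+1}}(x) | C(x;Q_j) = A) = 0` … a 'simple'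
bad configuration. However, `A` is admissible, whence `x` is `K`-regular, and we get a
contradiction"): if `x` is not `s`-bad at `ω`, then fewer than `s⁴ log⁷ s` translates `x + z`,
`z ∈ Q_s`, lie in `C(x; Q_j)(ω)`. [cite: KozmaNachmias2011, proof of Lemma 5.3 ((5.7), p. 401)] -/
theorem card_filter_add_mem_clusterIn_lt {p : unitInterval} {j s : ℕ} {x : Site d}
    {ω : BondConfig (Site d)} (h : ¬IsSBad p j s x ω) :
    (#((box d s).filter fun z => x + z ∈ clusterIn (box d j) x ω) : ℝ) < (s : ℝ) ^ 4 * Real.log s ^ 7 := by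
  classical
  by_contra hge
  rw [not_lt] at hge
  apply h
  -- `T_s(x)` misses the whole atom of `ω`
  have hempty : typicalEvent d s x ∩ clusterAtom (box d j) x ω = ∅ := by
    ext ω'
    simp only [Set.mem_inter_iff, Set.mem_empty_iff_false, iff_false, not_and]
    intro hT hat
    rw [typicalEvent, Set.mem_setOf_eq] at hT
    have hC := clusterIn_eq_of_mem_clusterAtom hat
    have hle : #((box d s).filter fun z => x + z ∈ clusterIn (box d j) x ω) ≤ localClusterCard d s x ω' := by
      unfold localClusterCard
      refine Finset.card_le_card fun z hz => ?_
      rw [Finset.mem_filter] at hz ⊢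
      rw [← hC] at hz
      exact ⟨hz.1, mem_openConn_of_mem_clusterIn hz.2⟩
    have hle' : (#((box d s).filter fun z => x + z ∈ clusterIn (box d j) x ω) : ℝ) ≤ localClusterCard d s x ω' := by
      exact_mod_cast hle
    linarith
  rw [IsSBad, condProbCluster, hempty, measureReal_empty, zero_div, sub_nonneg]
  exact Real.exp_le_one_iff.2 (neg_nonpos.2 (sq_nonneg _))

end NotBad

/-! ### The event `E₁(x, M, K)` -/

section EventE1

/-- **`E₁(x, M, K)`** (Kozma–Nachmias 2011, p. 399): "`E₁(x, M, K) = {0 ↔ x in Q_j, x is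
K-regular and X_j^{reg} = M}`", at parameter `p` and radius `j`, with `X_j^{reg} = X_j^{K-reg}`
(`regBoundaryConnCount`). [cite: KozmaNachmias2011, §5 (definition of E₁, p. 399)] -/
def eventE1 (p : unitInterval) (j K M : ℕ) (x : Site d) : Set (BondConfig (Site d)) :=
  openConnIn (↑(box d j) : Set (Site d)) (0 : Site d) x ∩
    ({ω | ¬IsKIrregular p j K x ω} ∩ {ω | regBoundaryConnCount d p j K ω = M})

variable {p : unitInterval} {j K M : ℕ} {x : Site d}

/-- Unfolding lemma. [folklore] -/
theorem mem_eventE1 {ω : BondConfig (Site d)} :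
    ω ∈ eventE1 p j K M x ↔ ω ∈ openConnIn (↑(box d j) : Set (Site d)) (0 : Site d) x ∧
      ¬IsKIrregular p j K x ω ∧ regBoundaryConnCount d p j K ω = M := by
  simp only [eventE1, Set.mem_inter_iff, Set.mem_setOf_eq]

/-- On `E₁`, `x` is not `s`-bad for any `s ≥ K`. [cite: KozmaNachmias2011, Definition 4.1 (ii)] -/
theorem not_isSBad_of_mem_eventE1 {ω : BondConfig (Site d)} (hω : ω ∈ eventE1 p j K M x) {s : ℕ}
    (hs : K ≤ s) : ¬IsSBad p j s x ω :=
  fun h => (mem_eventE1.1 hω).2.1 ⟨s, hs, h⟩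

/-- On `E₁`, the atom of the conditioning on `C(x; Q_j)` has positive probability (so the
"`A` admissible" of (5.3) is automatic). [cite: KozmaNachmias2011, proof of Lemma 5.3 ((5.3), p. 400)] -/
theorem measureReal_clusterAtom_pos_of_mem_eventE1 {ω : BondConfig (Site d)}
    (hω : ω ∈ eventE1 p j K M x) :
    0 < (bondPercolation (zdGraph d) p).real (clusterAtom (box d j) x ω) :=
  measureReal_clusterAtom_pos_of_not_isSBad (not_isSBad_of_mem_eventE1 hω le_rfl)

/-- `0 ↔ x in S` iff `0 ∈ C(x; S)`. [folklore] -/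
theorem mem_openConnIn_zero_iff_mem_clusterIn {S : Finset (Site d)} {x : Site d} {ω : BondConfig (Site d)} :
    ω ∈ openConnIn (↑S : Set (Site d)) (0 : Site d) x ↔ (0 : Site d) ∈ clusterIn S x ω := by
  rw [mem_clusterIn, openConnIn_mem_comm]

/-- On an atom of `C(x; Q_j)` containing `0`, the connections `0 ↔ x''` in `Q_j` and the
`K`-irregularity of the `x''` so connected do not change; hence neither does `X_j^{K-reg}`.
[cite: KozmaNachmias2011, proof of Lemma 5.3 (p. 400: "E₁ can be determined by observing only the edges of C(x;Q_j)")] -/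
theorem regBoundaryConnCount_eq_of_mem_clusterAtom {ω ω' : BondConfig (Site d)}
    (h0 : (0 : Site d) ∈ clusterIn (box d j) x ω) (hat : ω' ∈ clusterAtom (box d j) x ω) :
    regBoundaryConnCount d p j K ω' = regBoundaryConnCount d p j K ω := by
  classical
  have hC : clusterIn (box d j) x ω' = clusterIn (box d j) x ω := clusterIn_eq_of_mem_clusterAtom hat
  have h0' : (0 : Site d) ∈ clusterIn (box d j) x ω' := hC ▸ h0
  -- `C(0; Q_j)` agrees at `ω` and `ω'`
  have hC0 : clusterIn (box d j) 0 ω' = clusterIn (box d j) 0 ω := by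
    rw [clusterIn_eq_of_mem_clusterIn h0', clusterIn_eq_of_mem_clusterIn h0, hC]
  unfold regBoundaryConnCount
  congr 1
  refine Finset.filter_congr fun y _ => ?_
  rw [← mem_clusterIn, ← mem_clusterIn (ω := ω), hC0]
  refine and_congr_right fun hy => not_congr ?_
  -- `y ∈ C(0;Q_j)(ω) = C(x;Q_j)(ω)`: the atoms at `y` and at `x` coincide
  have hyx : y ∈ clusterIn (box d j) x ω := by rwa [clusterIn_eq_of_mem_clusterIn h0] at hy
  have hat' : ω' ∈ clusterAtom (box d j) y ω := by rwa [clusterAtom_eq_of_mem_clusterIn hyx]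
  exact isKIrregular_iff_of_mem_clusterAtom p hat'

/-- **`E₁` is saturated for the conditioning on `C(x; Q_j)`** ("`E₁` can be determined by observing
only the edges of `C(x; Q_j)`", Kozma–Nachmias 2011, p. 400): the atom of any `ω ∈ E₁` lies in
`E₁`. [cite: KozmaNachmias2011, proof of Lemma 5.3 (p. 400)] -/
theorem clusterAtom_subset_eventE1 :
    ∀ ω ∈ eventE1 p j K M x, clusterAtom (box d j) x ω ⊆ eventE1 (d := d) p j K M x := by
  intro ω hω ω' hat
  obtain ⟨h0, hreg, hM⟩ := mem_eventE1.1 hω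
  have h0C : (0 : Site d) ∈ clusterIn (box d j) x ω := mem_openConnIn_zero_iff_mem_clusterIn.1 h0
  refine mem_eventE1.2 ⟨?_, ?_, ?_⟩
  · rw [mem_openConnIn_zero_iff_mem_clusterIn, clusterIn_eq_of_mem_clusterAtom hat]
    exact h0C
  · rwa [isKIrregular_iff_of_mem_clusterAtom p hat]
  · rw [regBoundaryConnCount_eq_of_mem_clusterAtom h0C hat, hM]

/-- The cylinder of `ω ∈ E₁` over the conditioned pairs of `C(x; Q_j)(ω)` lies in `E₁` (the
witness form of saturation used with the BK–Reimer inequality, p. 402: "to verify `E₁ ∩ {0 ↔ z}`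
it suffices to observe the edges of `C(x; Q_j)` and `η`"). [cite: KozmaNachmias2011, proof of Lemma 5.5 (p. 402)] -/
theorem localCylinder_clusterPairs_subset_eventE1 {ω : BondConfig (Site d)} (hω : ω ∈ eventE1 p j K M x) :
    localCylinder (↑(clusterPairs (box d j) (clusterIn (box d j) x ω)) : Set (Sym2 (Site d))) ω ⊆
      eventE1 p j K M x :=
  clusterAtom_subset_eventE1 ω hω

/-- `E₁` is determined by the pairs of `Q_j` (it is local). [folklore] -/
theorem determinedBy_eventE1 (p : unitInterval) (j K M : ℕ) (x : Site d) :
    DeterminedBy (eventE1 (d := d) p j K M x) ↑(box d j).sym2 :=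
  determinedBy_of_saturated clusterAtom_subset_eventE1

/-- `E₁` is a local event. [folklore] -/
theorem isLocalEvent_eventE1 (p : unitInterval) (j K M : ℕ) (x : Site d) :
    IsLocalEvent (eventE1 (d := d) p j K M x) :=
  ⟨_, determinedBy_eventE1 p j K M x⟩

/-- `E₁` is measurable. [folklore] -/
theorem measurableSet_eventE1 (p : unitInterval) (j K M : ℕ) (x : Site d) :
    MeasurableSet (eventE1 (d := d) p j K M x) :=
  (determinedBy_eventE1 p j K M x).measurableSet_of_finset

/-- **The regularity estimate on `E₁`** (Kozma–Nachmias 2011, (5.11)–(5.12)): for `s ≥ K`,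
`P(E₁ ∩ ¬T_s(x)) ≤ e^{-log² s} P(E₁)`. [cite: KozmaNachmias2011, proof of Lemma 5.5 ((5.11)–(5.12), p. 403)] -/
theorem real_eventE1_inter_compl_typical_le (p : unitInterval) (j K M : ℕ) (x : Site d) {s : ℕ}
    (hs : K ≤ s) :
    (bondPercolation (zdGraph d) p).real (eventE1 p j K M x ∩ (typicalEvent d s x)ᶜ) ≤
      Real.exp (-(Real.log s ^ 2)) * (bondPercolation (zdGraph d) p).real (eventE1 p j K M x) := by
  refine real_inter_compl_le_of_saturated p clusterAtom_subset_eventE1 (measurableSet_typicalEvent d s x)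
    fun ω hω => ?_
  have h := not_isSBad_of_mem_eventE1 hω hs
  rw [IsSBad, not_le] at h
  linarith

/-- **(5.7) on `E₁`**: for `ω ∈ E₁` and `s ≥ K`, `|{z ∈ Q_s : x + z ∈ C(x;Q_j)(ω)}| < s⁴ log⁷ s`.
[cite: KozmaNachmias2011, proof of Lemma 5.3 ((5.7), p. 401)] -/
theorem card_filter_add_mem_clusterIn_lt_of_mem_eventE1 {ω : BondConfig (Site d)}
    (hω : ω ∈ eventE1 p j K M x) {s : ℕ} (hs : K ≤ s) :
    (#((box d s).filter fun z => x + z ∈ clusterIn (box d j) x ω) : ℝ) < (s : ℝ) ^ 4 * Real.log s ^ 7 :=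
  card_filter_add_mem_clusterIn_lt (not_isSBad_of_mem_eventE1 hω hs)

end EventE1

/-! ### Counting identities: `Σ_x P(E₁(x) ∩ H) = M · P({X^{K-reg} = M} ∩ H)` -/

section Counting

/-- **Counting identity** (generic): for events `G_a`, `a ∈ I`, a count `N` with
`N(ω) = |{a ∈ I : ω ∈ G_a}|` (given in indicator form) and an event `H`,
`Σ_{a ∈ I} P(G_a ∩ {N = M} ∩ H) = M · P({N = M} ∩ H)` (both sides equal `E[N; N = M, H]`). [folklore] -/
theorem sum_measureReal_inter_eq_mul {Ω ι : Type*} [MeasurableSpace Ω] (μ : Measure Ω)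
    [IsFiniteMeasure μ] (I : Finset ι) (G : ι → Set Ω) (hG : ∀ a ∈ I, MeasurableSet (G a))
    (N : Ω → ℕ) (hN : ∀ ω, (N ω : ℝ) = ∑ a ∈ I, (G a).indicator (1 : Ω → ℝ) ω) (M : ℕ)
    {H : Set Ω} (hFH : MeasurableSet ({ω | N ω = M} ∩ H)) :
    ∑ a ∈ I, μ.real (G a ∩ ({ω | N ω = M} ∩ H)) = M * μ.real ({ω | N ω = M} ∩ H) := by
  set F : Set Ω := {ω | N ω = M} with hF
  have hlhs : ∀ a ∈ I, μ.real (G a ∩ (F ∩ H)) =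
      ∫ ω, (G a ∩ (F ∩ H)).indicator (1 : Ω → ℝ) ω ∂μ :=
    fun a ha => (integral_indicator_one ((hG a ha).inter hFH)).symm
  have hint : ∀ a ∈ I, Integrable (fun ω => (G a ∩ (F ∩ H)).indicator (1 : Ω → ℝ) ω) μ :=
    fun a ha => (integrable_const (1 : ℝ)).indicator ((hG a ha).inter hFH)
  have hpt : ∀ ω, ∑ a ∈ I, (G a ∩ (F ∩ H)).indicator (1 : Ω → ℝ) ω =
      (F ∩ H).indicator (fun _ => (M : ℝ)) ω := by
    intro ω
    by_cases hω : ω ∈ F ∩ H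
    · rw [Set.indicator_of_mem hω]
      have : ∀ a ∈ I, (G a ∩ (F ∩ H)).indicator (1 : Ω → ℝ) ω = (G a).indicator (1 : Ω → ℝ) ω := by
        intro a _
        by_cases ha : ω ∈ G a
        · rw [Set.indicator_of_mem (show ω ∈ G a ∩ (F ∩ H) from ⟨ha, hω⟩), Set.indicator_of_mem ha]
        · rw [Set.indicator_of_notMem (fun h => ha h.1), Set.indicator_of_notMem ha]
      rw [Finset.sum_congr rfl this, ← hN ω]
      have hM : N ω = M := hω.1
      exact_mod_cast hM
    · rw [Set.indicator_of_notMem hω]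
      exact Finset.sum_eq_zero fun a _ => Set.indicator_of_notMem (fun h => hω h.2) _
  calc ∑ a ∈ I, μ.real (G a ∩ (F ∩ H))
      = ∑ a ∈ I, ∫ ω, (G a ∩ (F ∩ H)).indicator (1 : Ω → ℝ) ω ∂μ := Finset.sum_congr rfl hlhs
    _ = ∫ ω, ∑ a ∈ I, (G a ∩ (F ∩ H)).indicator (1 : Ω → ℝ) ω ∂μ := (integral_finsetSum I hint).symm
    _ = ∫ ω, (F ∩ H).indicator (fun _ => (M : ℝ)) ω ∂μ := integral_congr_ae (ae_of_all _ hpt)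
    _ = M * μ.real (F ∩ H) := by rw [integral_indicator_const _ hFH, smul_eq_mul, mul_comm]

variable {p : unitInterval} {j K M : ℕ}

/-- **`Σ_{x ∈ ∂Q_j} P(E₁(x) ∩ H) = M · P({X_j^{K-reg} = M} ∩ H)`** for measurable `H`
(Kozma–Nachmias 2011, p. 405: "`Σ_{x ∈ ∂Q_j} P(E₁(x)) = M P(X^{reg} = M)`, where the last equality
follows by definition of `E₁`"; the version with `H` gives the second moment below).
[cite: KozmaNachmias2011, proof of Lemma 5.2 (S₁, p. 405)] -/
theorem sum_real_eventE1_inter (p : unitInterval) (j K M : ℕ) {H : Set (BondConfig (Site d))}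
    (hH : MeasurableSet H) :
    ∑ x ∈ sphere d j, (bondPercolation (zdGraph d) p).real (eventE1 p j K M x ∩ H) =
      M * (bondPercolation (zdGraph d) p).real ({ω | regBoundaryConnCount d p j K ω = M} ∩ H) := by
  classical
  set G : Site d → Set (BondConfig (Site d)) := fun x =>
    openConnIn (↑(box d j) : Set (Site d)) (0 : Site d) x ∩ {ω | ¬IsKIrregular p j K x ω} with hG
  have hGm : ∀ x ∈ sphere d j, MeasurableSet (G x) := fun x _ =>
    (measurableSet_openConnIn (box d j) 0 x).inter (measurableSet_isKIrregular p j K x).compl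
  have hN : ∀ ω, (regBoundaryConnCount d p j K ω : ℝ) =
      ∑ x ∈ sphere d j, (G x).indicator (1 : BondConfig (Site d) → ℝ) ω := by
    intro ω
    have h1 : ∀ x ∈ sphere d j, (G x).indicator (1 : BondConfig (Site d) → ℝ) ω = if ω ∈ G x then 1 else 0 :=
      fun x _ => Set.indicator_apply (G x) 1 ω
    rw [Finset.sum_congr rfl h1, Finset.sum_boole]
    unfold regBoundaryConnCount
    congr 2
  have hFm : MeasurableSet ({ω | regBoundaryConnCount d p j K ω = M} ∩ H) := by
    refine MeasurableSet.inter ?_ hH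
    have : {ω : BondConfig (Site d) | regBoundaryConnCount d p j K ω = M} =
        (fun ω => (regBoundaryConnCount d p j K ω : ℝ)) ⁻¹' {(M : ℝ)} := by
      ext ω; simp
    rw [this]
    exact measurable_regBoundaryConnCount d p j K (measurableSet_singleton _)
  have key := sum_measureReal_inter_eq_mul (bondPercolation (zdGraph d) p) (sphere d j) G hGm
    (regBoundaryConnCount d p j K) hN M hFm
  rw [← key]
  refine Finset.sum_congr rfl fun x _ => ?_
  congr 1
  ext ω
  simp only [eventE1, hG, Set.mem_inter_iff, Set.mem_setOf_eq]
  tauto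

/-- `Σ_{x ∈ ∂Q_j} P(E₁(x)) = M · P(X_j^{K-reg} = M)`. [cite: KozmaNachmias2011, proof of Lemma 5.2 (S₁, p. 405)] -/
theorem sum_real_eventE1 (p : unitInterval) (j K M : ℕ) :
    ∑ x ∈ sphere d j, (bondPercolation (zdGraph d) p).real (eventE1 p j K M x) =
      M * (bondPercolation (zdGraph d) p).real {ω | regBoundaryConnCount d p j K ω = M} := by
  have h := sum_real_eventE1_inter (d := d) p j K M MeasurableSet.univ
  simpa only [Set.inter_univ] using h

/-- **`Σ_{x₁, x₂ ∈ ∂Q_j} P(E₁(x₁) ∩ E₁(x₂)) = M² · P(X_j^{K-reg} = M)`** (Kozma–Nachmias 2011, p. 406,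
the term `S₃`: `Σ_{x₁,x₂} P(E₁(x₁) ∩ E₁(x₂)) ⋯ = C M² L⁴ P(X^{reg} = M)`).
[cite: KozmaNachmias2011, proof of Lemma 5.2 (S₃, p. 406)] -/
theorem sum_sum_real_eventE1_inter_eventE1 (p : unitInterval) (j K M : ℕ) :
    ∑ x₁ ∈ sphere d j, ∑ x₂ ∈ sphere d j,
        (bondPercolation (zdGraph d) p).real (eventE1 p j K M x₁ ∩ eventE1 p j K M x₂) =
      (M : ℝ) ^ 2 * (bondPercolation (zdGraph d) p).real {ω | regBoundaryConnCount d p j K ω = M} := by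
  have h1 : ∀ x₁ ∈ sphere d j, ∑ x₂ ∈ sphere d j,
      (bondPercolation (zdGraph d) p).real (eventE1 p j K M x₁ ∩ eventE1 p j K M x₂) =
        M * (bondPercolation (zdGraph d) p).real (eventE1 p j K M x₁) := by
    intro x₁ _
    have h := sum_real_eventE1_inter (d := d) p j K M (measurableSet_eventE1 p j K M x₁)
    have heq : ∀ x₂ ∈ sphere d j, eventE1 p j K M x₁ ∩ eventE1 p j K M x₂ =
        eventE1 (d := d) p j K M x₂ ∩ eventE1 p j K M x₁ := fun x₂ _ => Set.inter_comm _ _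
    rw [Finset.sum_congr rfl fun x₂ hx₂ => by rw [heq x₂ hx₂], h]
    congr 1
    congr 1
    ext ω
    simp only [Set.mem_inter_iff, Set.mem_setOf_eq, mem_eventE1]
    tauto
  rw [Finset.sum_congr rfl h1, ← Finset.mul_sum, sum_real_eventE1, sq, mul_assoc]

end Counting

end Literature.Barriers.CriticalPhenomena

end
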